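import Literature.Barriers.AnomalousDissipation.GravestModeLaminarAttractorShell
import Literature.Analysis.FluidPDE.NSHopfExistenceProofs
import Literature.Analysis.FunctionSpaces.TorusEnstrophyOrthogonality
import HarnessLib

/-!
# Marchioro's trivial attractor: decay of the enstrophy excess along the Galerkin scheme
(proof file of `Literature/Barriers/AnomalousDissipation/GravestModeLaminarAttractor`; it
**discharges** the named half `firstMode_exists_lerayHopf_enstrophyExcess_tendsto_zero` of
`GravestModeLaminarAttractorExcess` — Foias–Manley–Rosa–Temam 2001, App. III.A.4,
(A.32)–(A.34), existence form)

The named fact asks, for every `α`, `ν > 0` and mean-zero divergence-free `u₀ ∈ L²(𝕋²)`, for a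
global Leray–Hopf solution of the 2-D Navier–Stokes equations with the first-mode force
`f_α = marchioroForce α` which is bounded in `L²` uniformly in time and whose enstrophy excess
`E(u(t)) = ‖u‖² - λ₁|u|² = ∑ (λ_k - λ₁)|û_k|²` tends to zero ((A.33)). The printed argument
(FMRT, App. III.A.4, PDF pp. 178–179) subtracts `λ₁ ×` the energy equation from the enstrophy
equation — the trilinear term drops out of both in the 2-D periodic case, `b(u,u,u) = 0` and
`b(u,u,Au) = 0` (II.A.62), and the force drops out of the difference because `Af = λ₁f` — to get
`½ d/dt E + νλ₅ E ≤ 0` ((A.32), `λ₅ = 8π²` the next eigenvalue of the unit torus), whence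
`E(t) → 0`.

We run this computation where it is an honest ODE computation: **at the Galerkin level**, along
the Fourier–Galerkin scheme of the tree (`NS.exists_galerkin_solution`, `NS.IsHopfGalerkinScheme`,
`IsHopfGalerkinScheme.exists_limitField`, `IsHopfGalerkinScheme.isLerayHopfOn_limit`, all proved
in `NSHopfGalerkinExistence` / `NSHopfLimit` / `NSHopfEnergy` / `NSHopfGalerkinLimit` in every
dimension) driven by the **exact** force `f_α`, which is its own truncation at every order
`N ≥ 1` (`fourierTruncate_marchioroForce`), and pass to the limit by Fatou on finite sets of
frequencies (the limit is coefficientwise at every time):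

* *Fourier identities on `𝕋²`* — (II.A.62) in Fourier variables,
  `∑ |k|² Re⟪c_k, 𝓕[(u·∇)u]_k⟫ = 0` (`sum_freqNormSq_mul_re_inner_convectionCoeff_eq_zero`, from
  the tree's `Torus.integral_inner_laplacian_convect_self_eq_zero` by Parseval); energy
  conservation `∑ Re⟪c_k, 𝓕[(u·∇)u]_k⟫ = 0`; no mean output `𝓕[(u·∇)u]_0 = 0`.
* *The weighted algebra (A.32)* — with the excess weights `w⁺(k) = max(4π²(|k|²-1), 0)`
  (`excessWeight`; `enstrophyExcess = ∑ ofReal (w⁺ ‖·‖²)`), for force coefficients on the first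
  shell: `∑ w⁺ Re⟪c_k, V(g,c)_k⟫ ≤ -8π²ν ∑ w⁺ ‖c_k‖²`
  (`sum_excessWeight_mul_re_inner_galerkinField_le`).
* *Galerkin solutions* — the mean mode is conserved (`galerkin_mean_eq`), hence zero for
  mean-zero data, which gives Poincaré `‖∇u‖² ≥ 4π²‖u‖²` along the solution and the uniform
  bound `∑‖α(t) k‖² ≤ ∑‖α(0) k‖² + ∑‖g k‖²/(16π⁴ν²)` ((II.A.42), `galerkin_sum_norm_sq_le`); the
  excess decays, `E(t) ≤ E(s)e^{-16π²ν(t-s)}` (`galerkin_excess_le_mul_exp`), and `E(1)` is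
  controlled by the data through the time-averaged enstrophy (`galerkin_excess_one_le`: the
  function `τE(τ) + ∑‖α‖²/(2ν) - τC` is non-increasing on `[0,1]`). The real-variable
  skeleton (`e^{cτ}E` non-increasing from `E' ≤ -cE` within `[0,T]`) is proved here.
* *The scheme and the limit* — `firstMode_exists_lerayHopf_enstrophyExcess_tendsto_zero_holds`:
  orders `N n = n + 1`, force coefficients `f̂_α` (real, no mean mode, supported on `|k|² = 1`),
  data `û₀` (real, transversal, no mean mode); the record `IsHopfGalerkinScheme` is filled exactly
  as in `NS.exists_isHopfGalerkinScheme`; the limit `u` is a global Leray–Hopf solution, and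
  `∫ ‖u(t)‖² ≤ K`, `E(u(t)) ≤ C e^{-16π²ν(t-1)}` for `t ≥ 1` follow coefficientwise.

## Mathlib / tree search

Galerkin scheme, its dictionary and the passage to the limit: tree (`NSGalerkinFourier`,
`NSHopfGalerkinExistence`, `NSHopfLimit`, `NSHopfGalerkinLimit`, generic dimension); (A.62):
tree (`TorusEnstrophyOrthogonality`); first-shell bookkeeping: tree
(`GravestModeLaminarAttractorShell`: `shellOne`, `mFourierCoeff_marchioroForce_zero`,
`integral_inner_realTrigPoly_zero_of_hasZeroMean`). From Mathlib: `antitoneOn_of_deriv_nonpos`,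
`constant_of_derivWithin_zero`, `HasDerivWithinAt.norm_sq`, `ENNReal.tsum_eq_iSup_sum`,
`tsum_le_of_sum_le`, `le_of_tendsto'`. Mathlib's `gronwallBound` lemmas are stated for
`HasDerivAt` on open sets of times; the one-sided version on `[0, T]` needed here is proved
directly (`le_mul_exp_neg_of_hasDerivWithinAt_le`).

## References

* C. Foias, O. Manley, R. Rosa, R. Temam, *Navier–Stokes Equations and Turbulence*, CUP 2001,
  Ch. II Thm. 7.1 (PDF p. 70), App. II.A (A.40)–(A.42) (p. 115), (A.62)–(A.65) (p. 118);
  App. III.A.4 (A.32)–(A.34) (pp. 178–179).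
* P. Constantin, C. Foias, *Navier–Stokes Equations*, Chicago 1988, Ch. 8 (Galerkin method).
* C. Marchioro, Comm. Math. Phys. 105 (1986) 99–106, (10)–(12).
-/

open MeasureTheory Set Filter Topology UnitAddTorus
open scoped ENNReal NNReal InnerProductSpace

noncomputable section

namespace Literature.Barriers.AnomalousDissipation

open Literature.Analysis.FunctionSpaces Literature.Analysis.FunctionSpaces.Torus
open Literature.Analysis.FluidPDE Literature.Analysis.FluidPDE.Torus

/-- The flat two-torus `T² = (ℝ/ℤ)²` (local notation). -/
local notation "𝕋²" => UnitAddTorus (Fin 2)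
/-- Velocity values on `T²` (local notation). -/
local notation "E²" => EuclideanSpace ℝ (Fin 2)
/-- Complexified velocity values (local notation). -/
local notation "ℂ²" => EuclideanSpace ℂ (Fin 2)
/-- The frequency lattice `ℤ²` (local notation). -/
local notation "ℤ²" => Fin 2 → ℤ

/-! ### Fourier-side identities for real divergence-free trigonometric polynomials on `𝕋²` -/

section Fourier

variable {S : Finset ℤ²}

/-- **(A.62) in Fourier variables.** For a conjugate-symmetric transversal coefficient family
`c` on a symmetric frequency set `S ⊂ ℤ²`, `∑_{k ∈ S} |k|² Re ⟪c k, 𝓕[(u·∇)u](k)⟫ = 0`,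
`u = realTrigPoly S c`: this is `(4π²)⁻¹ ∫ ⟪-Δu, (u·∇)u⟫ = 0`
(`Torus.integral_inner_laplacian_convect_self_eq_zero`; FMRT 2001, App. II.A (A.62)) read
through Parseval. [cite: FoiasManleyRosaTemam2001, App. II.A (A.62)] -/
theorem sum_freqNormSq_mul_re_inner_convectionCoeff_eq_zero (hS : ∀ k ∈ S, -k ∈ S)
    {c : ℤ² → ℂ²} (hc : IsConjSymm c) (hcT : IsTransversal S c) :
    ∑ k ∈ S, freqNormSq k * (inner ℂ (c k) (convectionCoeff S c c k)).re = 0 := by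
  have hu : IsSmooth (realTrigPoly S c) := isSmooth_realTrigPoly S c
  have hdiv : IsDivFree (realTrigPoly S c) := isDivFree_realTrigPoly hcT
  have hW : Integrable (convect (realTrigPoly S c) (realTrigPoly S c)) volume :=
    (hu.convect hu).integrable
  have h0 := integral_inner_laplacian_convect_self_eq_zero hu hdiv
  have h1 := integral_inner_realTrigPoly_of_integrable_left S
    (fun k => -(((4 * Real.pi ^ 2 * freqNormSq k : ℝ) : ℂ) • c k)) hW
  simp_rw [mFourierCoeff_convect_realTrigPoly hS hc hc] at h1
  have h2 : ∑ k ∈ S, (inner ℂ (-(((4 * Real.pi ^ 2 * freqNormSq k : ℝ) : ℂ) • c k))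
      (convectionCoeff S c c k)).re =
      -(4 * Real.pi ^ 2) * ∑ k ∈ S, freqNormSq k * (inner ℂ (c k) (convectionCoeff S c c k)).re := by
    rw [Finset.mul_sum]
    refine Finset.sum_congr rfl fun k _ => ?_
    rw [inner_neg_left, Complex.neg_re, inner_smul_left, Complex.conj_ofReal, Complex.re_ofReal_mul]
    ring
  have h3 : ∫ x, ⟪laplacian (realTrigPoly S c) x, convect (realTrigPoly S c) (realTrigPoly S c) x⟫_ℝ =
      -(4 * Real.pi ^ 2) * ∑ k ∈ S, freqNormSq k * (inner ℂ (c k) (convectionCoeff S c c k)).re := by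
    rw [← h2, ← h1]
    exact integral_congr_ae (ae_of_all _ fun x => by
      beta_reduce
      rw [laplacian_realTrigPoly])
  rw [h3] at h0
  have hπ : -(4 * Real.pi ^ 2) ≠ 0 := by
    have := Real.pi_pos; nlinarith
  exact (mul_eq_zero.1 h0).resolve_left hπ

/-- **The trilinear term conserves energy, in Fourier variables**:
`∑_{k ∈ S} Re ⟪c k, 𝓕[(u·∇)u](k)⟫ = ∫ ⟪u, (u·∇)u⟫ = 0` for `u = realTrigPoly S c` real and
divergence free (RRS 2016, (4.6); the cancellation inside `Torus.sum_re_inner_galerkinField_self`). [folklore] -/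
theorem sum_re_inner_convectionCoeff_eq_zero (hS : ∀ k ∈ S, -k ∈ S)
    {c : ℤ² → ℂ²} (hc : IsConjSymm c) (hcT : IsTransversal S c) :
    ∑ k ∈ S, (inner ℂ (c k) (convectionCoeff S c c k)).re = 0 := by
  have hu : IsSmooth (realTrigPoly S c) := isSmooth_realTrigPoly S c
  have hdiv : IsDivFree (realTrigPoly S c) := isDivFree_realTrigPoly hcT
  have h1 := integral_inner_realTrigPoly_left hS hc ((hu.convect hu).memLp 2)
  simp_rw [mFourierCoeff_convect_realTrigPoly hS hc hc] at h1
  rw [← h1]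
  calc ∫ x, ⟪realTrigPoly S c x, convect (realTrigPoly S c) (realTrigPoly S c) x⟫_ℝ
      = ∫ x, ⟪convect (realTrigPoly S c) (realTrigPoly S c) x, realTrigPoly S c x⟫_ℝ :=
        integral_congr_ae (ae_of_all _ fun x => real_inner_comm _ _)
    _ = 0 := integral_inner_convect_self_eq_zero hu hdiv

/-- The mean output of the convection symbol vanishes for conjugate-symmetric transversal
coefficients: `𝓕[(u·∇)u](0) = ∑_{m} (2πi c(-m)·m) c m = 0` since `c(-m)·m = conj (m · c m) = 0`. [folklore] -/
theorem convectionCoeff_zero_eq_zero {c : ℤ² → ℂ²} (hc : IsConjSymm c)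
    (hcT : IsTransversal S c) : convectionCoeff S c c 0 = 0 := by
  rw [convectionCoeff_def]
  refine Finset.sum_eq_zero fun l hl => Finset.sum_eq_zero fun m hm => ?_
  split_ifs with hlm
  · have hl' : l = -m := eq_neg_of_add_eq_zero_left hlm
    subst hl'
    have h : ∑ j, c (-m) j * (m j : ℂ) = 0 := by
      rw [hc m]
      simp only [EuclideanSpace.conjVec_apply]
      have := congr_arg (starRingEnd ℂ) (hcT m hm)
      rw [map_sum, map_zero] at this
      rw [← this]
      refine Finset.sum_congr rfl fun j _ => ?_
      rw [map_mul, map_intCast, mul_comm]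
    rw [h, mul_zero, zero_smul]
  · rfl

end Fourier

/-! ### Real-variable lemmas: monotonicity from one-sided derivative information -/

section RealVariable

/-- A function continuous on `[a, b]` with nonpositive derivative on `(a, b)` does not increase:
`φ b ≤ φ a`. [folklore] -/
theorem apply_le_apply_of_hasDerivAt_nonpos {φ φ' : ℝ → ℝ} {a b : ℝ} (hab : a ≤ b)
    (hcont : ContinuousOn φ (Icc a b)) (hderiv : ∀ x ∈ Ioo a b, HasDerivAt φ (φ' x) x)
    (hnonpos : ∀ x ∈ Ioo a b, φ' x ≤ 0) : φ b ≤ φ a := by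
  have hanti : AntitoneOn φ (Icc a b) := by
    refine antitoneOn_of_deriv_nonpos (convex_Icc a b) hcont ?_ ?_
    · rw [interior_Icc]
      exact fun x hx => (hderiv x hx).differentiableAt.differentiableWithinAt
    · rw [interior_Icc]
      intro x hx
      rw [(hderiv x hx).deriv]
      exact hnonpos x hx
  exact hanti (left_mem_Icc.2 hab) (right_mem_Icc.2 hab) hab

/-- **Exponential decay from a differential inequality.** If `E` has derivative `E'` within
`[0, T]` at every point of `[0, T]` and `E' ≤ -c E` there, then
`E t ≤ E s · e^{-c (t - s)}` for `0 ≤ s ≤ t ≤ T` (`e^{cτ} E(τ)` is non-increasing). [folklore] -/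
theorem le_mul_exp_neg_of_hasDerivWithinAt_le {E E' : ℝ → ℝ} {T c : ℝ}
    (hE : ∀ τ ∈ Icc 0 T, HasDerivWithinAt E (E' τ) (Icc 0 T) τ) (hle : ∀ τ ∈ Icc 0 T, E' τ ≤ -c * E τ)
    {s t : ℝ} (hs : 0 ≤ s) (hst : s ≤ t) (htT : t ≤ T) :
    E t ≤ E s * Real.exp (-c * (t - s)) := by
  set φ : ℝ → ℝ := fun τ => Real.exp (c * τ) * E τ with hφ
  have hφd : ∀ τ ∈ Icc 0 T, HasDerivWithinAt φ (Real.exp (c * τ) * (E' τ + c * E τ)) (Icc 0 T) τ := by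
    intro τ hτ
    have h1 : HasDerivWithinAt (fun σ => Real.exp (c * σ)) (Real.exp (c * τ) * c) (Icc 0 T) τ := by
      have h := ((hasDerivAt_id τ).const_mul c).exp
      simp only [id, mul_one] at h
      exact h.hasDerivWithinAt
    have h := h1.mul (hE τ hτ)
    refine h.congr_deriv ?_
    ring
  have hkey : φ t ≤ φ s := by
    refine apply_le_apply_of_hasDerivAt_nonpos (φ' := fun τ => Real.exp (c * τ) * (E' τ + c * E τ))
      hst (fun τ hτ => (hφd τ ⟨hs.trans hτ.1, hτ.2.trans htT⟩).continuousWithinAt.mono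
        (Icc_subset_Icc hs htT)) (fun τ hτ => ?_) (fun τ hτ => ?_)
    · have hτT : τ ∈ Icc 0 T := ⟨hs.trans hτ.1.le, hτ.2.le.trans htT⟩
      exact (hφd τ hτT).hasDerivAt (Icc_mem_nhds (hs.trans_lt hτ.1) (hτ.2.trans_le htT))
    · have hτT : τ ∈ Icc 0 T := ⟨hs.trans hτ.1.le, hτ.2.le.trans htT⟩
      have := hle τ hτT
      have hexp := Real.exp_pos (c * τ)
      nlinarith
  -- unfold `φ`
  have hts : Real.exp (c * t) * E t ≤ Real.exp (c * s) * E s := hkey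
  have hexp_t := Real.exp_pos (c * t)
  calc E t = Real.exp (-(c * t)) * (Real.exp (c * t) * E t) := by
        rw [← mul_assoc, ← Real.exp_add, neg_add_cancel, Real.exp_zero, one_mul]
    _ ≤ Real.exp (-(c * t)) * (Real.exp (c * s) * E s) :=
        mul_le_mul_of_nonneg_left hts (Real.exp_pos _).le
    _ = E s * Real.exp (-c * (t - s)) := by
        rw [← mul_assoc, ← Real.exp_add, mul_comm, show -(c * t) + c * s = -c * (t - s) by ring]

/-- **Linear comparison.** If `ψ` has derivative `ψ'` within `[0, T]` at every point of `[0, T]`,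
`ψ' ≤ -c ψ + A` with `c > 0`, `A ≥ 0`, `ψ 0 ≥ 0`, then `ψ t ≤ ψ 0 + A / c` on `[0, T]`
(`e^{cτ}(ψ - A/c)` is non-increasing). [folklore] -/
theorem le_add_div_of_hasDerivWithinAt_le {ψ ψ' : ℝ → ℝ} {T c A : ℝ} (hc : 0 < c) (hA : 0 ≤ A)
    (hψ0 : 0 ≤ ψ 0) (hψ : ∀ τ ∈ Icc 0 T, HasDerivWithinAt ψ (ψ' τ) (Icc 0 T) τ)
    (hle : ∀ τ ∈ Icc 0 T, ψ' τ ≤ -c * ψ τ + A) {t : ℝ} (ht : t ∈ Icc 0 T) :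
    ψ t ≤ ψ 0 + A / c := by
  have hc0 : c ≠ 0 := hc.ne'
  have hAc : 0 ≤ A / c := div_nonneg hA hc.le
  have hE : ∀ τ ∈ Icc 0 T, HasDerivWithinAt (fun σ => ψ σ - A / c) (ψ' τ) (Icc 0 T) τ :=
    fun τ hτ => (hψ τ hτ).sub_const _
  have hle' : ∀ τ ∈ Icc 0 T, ψ' τ ≤ -c * (ψ τ - A / c) := fun τ hτ => by
    have h1 := hle τ hτ
    have h2 : -c * (ψ τ - A / c) = -c * ψ τ + A := by
      rw [mul_sub, neg_mul, neg_mul, mul_div_cancel₀ _ hc0]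
      ring
    linarith
  have h := le_mul_exp_neg_of_hasDerivWithinAt_le hE hle' le_rfl ht.1 ht.2
  simp only [sub_zero] at h
  have hexp : Real.exp (-c * t) ≤ 1 := by
    rw [Real.exp_le_one_iff]; nlinarith [ht.1]
  have hexp0 : 0 < Real.exp (-c * t) := Real.exp_pos _
  by_cases h0 : 0 ≤ ψ 0 - A / c
  · have : (ψ 0 - A / c) * Real.exp (-c * t) ≤ (ψ 0 - A / c) * 1 :=
      mul_le_mul_of_nonneg_left hexp h0
    linarith
  · push Not at h0
    have : (ψ 0 - A / c) * Real.exp (-c * t) ≤ 0 := mul_nonpos_of_nonpos_of_nonneg h0.le hexp0.le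
    linarith

end RealVariable

/-! ### The enstrophy-excess weight -/

/-- **The enstrophy-excess weight** `w⁺(k) = max (4π²(|k|² - 1)) 0`: `4π²(|k|² - 1) = λ_k - λ₁`
for `k ≠ 0` (unit torus, `λ_k = 4π²|k|²`, `λ₁ = 4π²`) and `0` at the mean mode; these are the
weights of `enstrophyExcess` (`‖u‖² - λ₁|u|² = ∑ (λ_k - λ₁)|û_k|²`, FMRT 2001, App. III.A.4,
display after (A.32)). [cite: FoiasManleyRosaTemam2001, App. III.A.4 (A.32)–(A.33)] -/
def excessWeight (k : ℤ²) : ℝ :=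
  max (4 * Real.pi ^ 2 * (freqNormSq k - 1)) 0

/-- The weight is nonnegative. [folklore] -/
theorem excessWeight_nonneg (k : ℤ²) : 0 ≤ excessWeight k :=
  le_max_right _ _

/-- Off the mean mode the weight is `4π²(|k|² - 1)` (`|k|² ≥ 1` for `k ≠ 0`). [folklore] -/
theorem excessWeight_of_ne_zero {k : ℤ²} (hk : k ≠ 0) :
    excessWeight k = 4 * Real.pi ^ 2 * (freqNormSq k - 1) := by
  refine max_eq_left ?_
  have h1 := one_le_freqNormSq hk
  have hπ := Real.pi_pos
  nlinarith

/-- The weight vanishes at the mean mode. [folklore] -/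
theorem excessWeight_zero : excessWeight (0 : ℤ²) = 0 := by
  rw [excessWeight, freqNormSq_zero]
  refine max_eq_right ?_
  nlinarith [Real.pi_pos]

/-- The weight vanishes on the first shell and at the mean mode: `|k|² ≤ 1 ⇒ w⁺(k) = 0`. [folklore] -/
theorem excessWeight_eq_zero_of_le {k : ℤ²} (hk : freqNormSq k ≤ 1) : excessWeight k = 0 := by
  refine max_eq_right ?_
  nlinarith [Real.pi_pos]

/-- Where the weight is non-zero, `|k|² ≥ 2` (the next eigenvalue is `λ₅ = 8π²`). [folklore] -/
theorem two_le_freqNormSq_of_excessWeight_ne_zero {k : ℤ²} (hk : excessWeight k ≠ 0) :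
    2 ≤ freqNormSq k := by
  refine two_le_freqNormSq_of_one_lt (not_le.1 fun h => hk (excessWeight_eq_zero_of_le h))

/-- `w⁺(k) ≤ 4π²|k|²` (the excess is at most the enstrophy). [folklore] -/
theorem excessWeight_le (k : ℤ²) : excessWeight k ≤ 4 * Real.pi ^ 2 * freqNormSq k := by
  refine max_le ?_ ?_
  · nlinarith [Real.pi_pos]
  · exact mul_nonneg (by positivity) (freqNormSq_nonneg k)

/-- The extended weight of `enstrophyExcess` is `ofReal` of `w⁺`. [folklore] -/
theorem ofReal_excessWeight (k : ℤ²) :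
    ENNReal.ofReal (excessWeight k) = ENNReal.ofReal (4 * Real.pi ^ 2 * (freqNormSq k - 1)) := by
  rw [excessWeight]
  rcases le_total (4 * Real.pi ^ 2 * (freqNormSq k - 1)) 0 with h | h
  · rw [max_eq_right h, ENNReal.ofReal_zero, ENNReal.ofReal_of_nonpos h]
  · rw [max_eq_left h]

/-- `enstrophyExcess v = ∑' ofReal (w⁺(k) ‖v̂(k)‖²)`. [folklore] -/
theorem enstrophyExcess_eq_tsum_ofReal (v : 𝕋² → E²) :
    enstrophyExcess v = ∑' k : ℤ², ENNReal.ofReal (excessWeight k *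
      ‖mFourierCoeff (EuclideanSpace.complexify ∘ v) k‖ ^ 2) := by
  rw [enstrophyExcess_def]
  refine tsum_congr fun k => ?_
  rw [ENNReal.ofReal_mul (excessWeight_nonneg k), ofReal_excessWeight, ← ofReal_norm,
    ENNReal.ofReal_pow (norm_nonneg _)]

/-! ### The weighted energy identity along a coefficient curve -/

section Weighted

variable {S : Finset ℤ²}

/-- Derivative of a weighted coefficient energy `∑_k w_k ‖β k‖²` along a differentiable curve in
`S → ℂ²`: `d/dt ∑ w_k ‖β k‖² = ∑ w_k · 2 Re ⟪β k, β' k⟫`. [folklore] -/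
theorem hasDerivWithinAt_sum_mul_norm_sq {β : ℝ → ↥S → ℂ²} {v : ↥S → ℂ²} {s : Set ℝ} {t : ℝ}
    (h : HasDerivWithinAt β v s t) (w : ↥S → ℝ) :
    HasDerivWithinAt (fun τ => ∑ k, w k * ‖β τ k‖ ^ 2)
      (∑ k, w k * (2 * (inner ℂ (β t k) (v k)).re)) s t := by
  have hk : ∀ k : ↥S, HasDerivWithinAt (fun τ => β τ k) (v k) s t := fun k =>
    (ContinuousLinearMap.proj (R := ℝ) (φ := fun _ : ↥S => ℂ²) k).hasFDerivAt
      |>.comp_hasDerivWithinAt t h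
  have := HasDerivWithinAt.fun_sum (u := Finset.univ) fun k _ => ((hk k).norm_sq).const_mul (w k)
  simp only [real_inner_eq_re_inner_euclidean] at this
  convert this using 1

/-- **The excess-weighted Galerkin field** (the algebra of (A.32) at the Galerkin level). Let
`S ⊂ ℤ²` be symmetric, `c` conjugate symmetric and transversal on `S`, `ν ≥ 0`, and let the
force coefficients `g` live on the first shell (`g k = 0` unless `|k|² = 1`). Then
`∑_{k∈S} w⁺(k) Re ⟪c k, V(g,c) k⟫ ≤ -8π²ν ∑_{k∈S} w⁺(k) ‖c k‖²`, `V = Torus.galerkinField ν S g c`: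
the Stokes part gives `-ν ∑ w⁺ 4π²|k|² ‖c_k‖² ≤ -8π²ν ∑ w⁺ ‖c_k‖²` (`|k|² ≥ 2` where
`w⁺ ≠ 0`), the force drops out (`w⁺ = 0` on the first shell — "`(f, Au) = λ₁(f, u)`"), and
the convection drops out because `∑ w⁺ Re⟪c_k, 𝓕[(u·∇)u]_k⟫ = 4π²(∑ |k|² Re⟪·⟫ - ∑ Re⟪·⟫)
= 4π²(b(u,u,Au)/4π² - b(u,u,u)) = 0` (FMRT 2001, App. III.A.4, (A.32): energy equation times
`λ₁` subtracted from the enstrophy equation, with (II.A.62)). [cite: FoiasManleyRosaTemam2001, App. III.A.4 (A.32)] -/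
theorem sum_excessWeight_mul_re_inner_galerkinField_le {ν : ℝ} (hν : 0 ≤ ν)
    (hS : ∀ k ∈ S, -k ∈ S) {g c : ℤ² → ℂ²} (hc : IsConjSymm c) (hcT : IsTransversal S c)
    (hg1 : ∀ k, freqNormSq k ≠ 1 → g k = 0) :
    ∑ k ∈ S, excessWeight k * (inner ℂ (c k) (galerkinField ν S g c k)).re ≤
      -(8 * Real.pi ^ 2 * ν) * ∑ k ∈ S, excessWeight k * ‖c k‖ ^ 2 := by
  -- split the field
  have hsplit : ∀ k ∈ S, (inner ℂ (c k) (galerkinField ν S g c k)).re =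
      -(ν * (4 * Real.pi ^ 2 * (freqNormSq k * ‖c k‖ ^ 2))) +
        ((inner ℂ (c k) (g k)).re - (inner ℂ (c k) (convectionCoeff S c c k)).re) := by
    intro k hk
    rw [galerkinField, inner_add_right, Complex.add_re, inner_leraySym_right_of_transversal _ _
      (hcT k hk), inner_sub_right, Complex.sub_re, inner_neg_right, Complex.neg_re,
      inner_smul_right, Complex.re_ofReal_mul]
    have hcc : (inner ℂ (c k) (c k)).re = ‖c k‖ ^ 2 := inner_self_eq_norm_sq (𝕜 := ℂ) (c k)
    rw [hcc]
    ring
  have hsum : ∑ k ∈ S, excessWeight k * (inner ℂ (c k) (galerkinField ν S g c k)).re =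
      (∑ k ∈ S, -(ν * (excessWeight k * (4 * Real.pi ^ 2 * freqNormSq k) * ‖c k‖ ^ 2))) +
        (∑ k ∈ S, excessWeight k * (inner ℂ (c k) (g k)).re) -
          ∑ k ∈ S, excessWeight k * (inner ℂ (c k) (convectionCoeff S c c k)).re := by
    rw [← Finset.sum_add_distrib, ← Finset.sum_sub_distrib]
    refine Finset.sum_congr rfl fun k hk => ?_
    rw [hsplit k hk]
    ring
  -- the force drops out
  have hforce : ∑ k ∈ S, excessWeight k * (inner ℂ (c k) (g k)).re = 0 := by
    refine Finset.sum_eq_zero fun k _ => ?_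
    by_cases h1 : freqNormSq k = 1
    · rw [excessWeight_eq_zero_of_le h1.le, zero_mul]
    · rw [hg1 k h1, inner_zero_right, Complex.zero_re, mul_zero]
  -- the convection drops out
  have hconv : ∑ k ∈ S, excessWeight k * (inner ℂ (c k) (convectionCoeff S c c k)).re = 0 := by
    have hterm : ∀ k ∈ S, excessWeight k * (inner ℂ (c k) (convectionCoeff S c c k)).re =
        4 * Real.pi ^ 2 * (freqNormSq k * (inner ℂ (c k) (convectionCoeff S c c k)).re) -
          4 * Real.pi ^ 2 * (inner ℂ (c k) (convectionCoeff S c c k)).re := by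
      intro k _
      by_cases hk0 : k = 0
      · subst hk0
        rw [convectionCoeff_zero_eq_zero hc hcT, inner_zero_right, Complex.zero_re]
        ring
      · rw [excessWeight_of_ne_zero hk0]
        ring
    rw [Finset.sum_congr rfl hterm, Finset.sum_sub_distrib, ← Finset.mul_sum, ← Finset.mul_sum,
      sum_freqNormSq_mul_re_inner_convectionCoeff_eq_zero hS hc hcT,
      sum_re_inner_convectionCoeff_eq_zero hS hc hcT, mul_zero, sub_zero]
  rw [hsum, hforce, hconv, add_zero, sub_zero, Finset.mul_sum]
  refine Finset.sum_le_sum fun k _ => ?_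
  -- termwise: `-ν w 4π²|k|² ‖c‖² ≤ -8π²ν w ‖c‖²`
  by_cases hw : excessWeight k = 0
  · rw [hw]; simp
  · have h2 := two_le_freqNormSq_of_excessWeight_ne_zero hw
    have hw0 := excessWeight_nonneg k
    have hc2 := sq_nonneg ‖c k‖
    have hπ : 0 < Real.pi ^ 2 := by positivity
    have hprod : 0 ≤ ν * excessWeight k * ‖c k‖ ^ 2 := by positivity
    have hkey : 0 ≤ ν * excessWeight k * ‖c k‖ ^ 2 * (freqNormSq k - 2) * Real.pi ^ 2 :=
      mul_nonneg (mul_nonneg hprod (by linarith)) hπ.le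
    nlinarith

/-- The Galerkin field has no mean output when the force has no mean mode:
`V(g, c)(0) = Π₀(g 0 - 𝓕[(u·∇)u](0)) = 0` (the Stokes multiplier vanishes at `k = 0`, and so do
`g 0` and the convection symbol). [folklore] -/
theorem galerkinField_zero_eq_zero {ν : ℝ} {g c : ℤ² → ℂ²}
    (hc : IsConjSymm c) (hcT : IsTransversal S c) (hg0 : g 0 = 0) :
    galerkinField ν S g c 0 = 0 := by
  rw [galerkinField, convectionCoeff_zero_eq_zero hc hcT, hg0, sub_zero, leraySym_zero,
    freqNormSq_zero]
  simp

end Weighted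

/-! ### Galerkin solutions on `𝕋²`: mean, uniform energy bound, decay of the enstrophy excess -/

section GalerkinSolution

variable {S : Finset ℤ²} {ν : ℝ} {g : ↥S → ℂ²} {α : ℝ → ↥S → ℂ²}

/-- **Conservation of the mean mode.** Along a Galerkin solution `α` (phase-space valued,
solving `α' = V(g, α)` within every `[0, T]`) driven by force coefficients with no mean mode,
the mean coefficient `α t 0` is constant in `t ≥ 0`: its derivative is `V(g, α)(0) = 0`
(`galerkinField_zero_eq_zero`). [folklore] -/
theorem galerkin_mean_eq (hS : ∀ k ∈ S, -k ∈ S) (hmem : ∀ t, α t ∈ galerkinSubspace S)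
    (hα : ∀ T, ∀ t ∈ Icc 0 T, HasDerivWithinAt α (galerkinRHS S ν g (α t)) (Icc 0 T) t)
    (h0S : (0 : ℤ²) ∈ S) (hg0 : g ⟨0, h0S⟩ = 0) {t : ℝ} (ht : 0 ≤ t) :
    α t ⟨0, h0S⟩ = α 0 ⟨0, h0S⟩ := by
  rcases eq_or_lt_of_le ht with h | ht'
  · rw [← h]
  have hd : ∀ τ ∈ Icc 0 t, HasDerivWithinAt (fun σ => α σ ⟨0, h0S⟩) 0 (Icc 0 t) τ := by
    intro τ hτ
    have h := (ContinuousLinearMap.proj (R := ℝ) (φ := fun _ : ↥S => ℂ²) ⟨0, h0S⟩).hasFDerivAt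
      |>.comp_hasDerivWithinAt τ (hα t τ hτ)
    have hz : galerkinRHS S ν g (α τ) ⟨0, h0S⟩ = 0 := by
      rw [galerkinRHS_apply]
      refine galerkinField_zero_eq_zero ((hmem τ).1.isConjSymm_coeffExt hS)
        (hmem τ).2.isTransversal_coeffExt ?_
      rw [coeffExt_of_mem _ h0S]
      exact hg0
    have h' : HasDerivWithinAt (fun σ => α σ ⟨0, h0S⟩) (galerkinRHS S ν g (α τ) ⟨0, h0S⟩) (Icc 0 t) τ := h
    rwa [hz] at h'
  have hdiff : DifferentiableOn ℝ (fun σ => α σ ⟨0, h0S⟩) (Icc 0 t) := fun τ hτ =>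
    (hd τ hτ).differentiableWithinAt
  have hderiv : ∀ τ ∈ Ico 0 t, derivWithin (fun σ => α σ ⟨0, h0S⟩) (Icc 0 t) τ = 0 := fun τ hτ =>
    (hd τ (Ico_subset_Icc_self hτ)).derivWithin (uniqueDiffOn_Icc ht' τ (Ico_subset_Icc_self hτ))
  exact constant_of_derivWithin_zero hdiff hderiv t (right_mem_Icc.2 ht)

/-- The force power against a Galerkin state in Fourier variables:
`∫ ⟪G, u⟫ = ∑_k Re ⟪g k, α k⟫` for `G = realTrigPoly S ḡ`, `u = realTrigPoly S ᾱ`. [folklore] -/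
theorem integral_inner_realTrigPoly_coeffExt (hS : ∀ k ∈ S, -k ∈ S) (hg : IsRealCoeff g)
    {c : ↥S → ℂ²} (hc : IsRealCoeff c) :
    ∫ x, ⟪realTrigPoly S (coeffExt S g) x, realTrigPoly S (coeffExt S c) x⟫_ℝ =
      ∑ k, (inner ℂ (g k) (c k)).re := by
  rw [integral_inner_realTrigPoly_realTrigPoly hS (hg.isConjSymm_coeffExt hS)
    (hc.isConjSymm_coeffExt hS), ← Finset.sum_coe_sort]
  exact Finset.sum_congr rfl fun k _ => by rw [coeffExt_coe, coeffExt_coe]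

/-- **The uniform energy bound of Galerkin solutions with mean-free data** (FMRT 2001,
App. II.A (A.42) at the Galerkin level: `|u(t)|² ≤ |u₀|²e^{-νλ₁t} + |f|²(ν²λ₁²)⁻¹(1 - e^{-νλ₁t})`,
here in the crude form `∑ ‖α t k‖² ≤ ∑ ‖α 0 k‖² + ∑ ‖g k‖²/(16π⁴ν²)`). With zero mean mode
(`α 0 0 = 0`, force without mean mode) the Poincaré inequality `‖∇u‖² ≥ 4π²‖u‖²` holds along
the solution, and `d/dt ∑‖α k‖² = 2(-ν‖∇u‖² + ⟨G,u⟩) ≤ -4π²ν ∑‖α k‖² + ∑‖g k‖²/(4π²ν)`. [cite: FoiasManleyRosaTemam2001, App. II.A (A.42)] -/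
theorem galerkin_sum_norm_sq_le (hν : 0 < ν) (hS : ∀ k ∈ S, -k ∈ S) (hg : IsRealCoeff g)
    (hmem : ∀ t, α t ∈ galerkinSubspace S)
    (hα : ∀ T, ∀ t ∈ Icc 0 T, HasDerivWithinAt α (galerkinRHS S ν g (α t)) (Icc 0 T) t)
    (h0S : (0 : ℤ²) ∈ S) (hg0 : g ⟨0, h0S⟩ = 0) (hα0 : α 0 ⟨0, h0S⟩ = 0) {t : ℝ} (ht : 0 ≤ t) :
    ∑ k, ‖α t k‖ ^ 2 ≤ (∑ k, ‖α 0 k‖ ^ 2) + (∑ k, ‖g k‖ ^ 2) / (16 * Real.pi ^ 4 * ν ^ 2) := by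
  set Gf : ℝ := ∑ k, ‖g k‖ ^ 2 with hGf
  have hGf0 : 0 ≤ Gf := Finset.sum_nonneg fun k _ => sq_nonneg _
  have hc : 0 < 4 * Real.pi ^ 2 * ν := by positivity
  have hderiv : ∀ τ ∈ Icc 0 t, HasDerivWithinAt (fun σ => ∑ k, ‖α σ k‖ ^ 2)
      (2 * (-(ν * (eGradNormSq (realTrigPoly S (coeffExt S (α τ)))).toReal) +
        ∫ x, ⟪realTrigPoly S (coeffExt S g) x, realTrigPoly S (coeffExt S (α τ)) x⟫_ℝ)) (Icc 0 t) τ :=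
    fun τ hτ => hasDerivWithinAt_energy ν hS (hα t τ hτ) (hmem τ) hg
  have hle : ∀ τ ∈ Icc 0 t,
      2 * (-(ν * (eGradNormSq (realTrigPoly S (coeffExt S (α τ)))).toReal) +
        ∫ x, ⟪realTrigPoly S (coeffExt S g) x, realTrigPoly S (coeffExt S (α τ)) x⟫_ℝ) ≤
      -(4 * Real.pi ^ 2 * ν) * (∑ k, ‖α τ k‖ ^ 2) + Gf / (4 * Real.pi ^ 2 * ν) := by
    intro τ hτ
    -- Poincaré along the solution (mean mode zero)
    have hmean : α τ ⟨0, h0S⟩ = 0 := by rw [galerkin_mean_eq hS hmem hα h0S hg0 hτ.1, hα0]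
    have hgrad : (eGradNormSq (realTrigPoly S (coeffExt S (α τ)))).toReal ≥
        4 * Real.pi ^ 2 * ∑ k, ‖α τ k‖ ^ 2 := by
      rw [toReal_eGradNormSq_coeffExt hS (hmem τ).1, ge_iff_le]
      refine mul_le_mul_of_nonneg_left (Finset.sum_le_sum fun k _ => ?_) (by positivity)
      by_cases hk : (k : ℤ²) = 0
      · have : k = ⟨0, h0S⟩ := Subtype.ext hk
        rw [this, hmean]
        simp
      · have h1 := one_le_freqNormSq hk
        nlinarith [sq_nonneg ‖α τ k‖]
    -- the power
    have hP : ∫ x, ⟪realTrigPoly S (coeffExt S g) x, realTrigPoly S (coeffExt S (α τ)) x⟫_ℝ ≤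
        Gf / (2 * (4 * Real.pi ^ 2 * ν)) + (4 * Real.pi ^ 2 * ν) / 2 * ∑ k, ‖α τ k‖ ^ 2 := by
      rw [integral_inner_realTrigPoly_coeffExt hS hg (hmem τ).1, hGf, Finset.sum_div, Finset.mul_sum,
        ← Finset.sum_add_distrib]
      refine Finset.sum_le_sum fun k _ => ?_
      have h1 : (inner ℂ (g k) (α τ k)).re ≤ ‖g k‖ * ‖α τ k‖ := re_inner_le_norm (𝕜 := ℂ) (g k) (α τ k)
      -- Young: `ab ≤ a²/(2ε) + ε b²/2`
      have hε := hc
      have key : ‖g k‖ * ‖α τ k‖ ≤ ‖g k‖ ^ 2 / (2 * (4 * Real.pi ^ 2 * ν)) +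
          (4 * Real.pi ^ 2 * ν) / 2 * ‖α τ k‖ ^ 2 := by
        rw [div_add' _ _ _ (by positivity), le_div_iff₀ (by positivity)]
        nlinarith [sq_nonneg (‖g k‖ - (4 * Real.pi ^ 2 * ν) * ‖α τ k‖)]
      exact h1.trans key
    have hνG : ν * (4 * Real.pi ^ 2 * ∑ k, ‖α τ k‖ ^ 2) ≤
        ν * (eGradNormSq (realTrigPoly S (coeffExt S (α τ)))).toReal :=
      mul_le_mul_of_nonneg_left hgrad hν.le
    have hdiv2 : 2 * (Gf / (2 * (4 * Real.pi ^ 2 * ν))) = Gf / (4 * Real.pi ^ 2 * ν) := by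
      field_simp
    linarith
  have h := le_add_div_of_hasDerivWithinAt_le (T := t) hc (div_nonneg hGf0 hc.le)
    (Finset.sum_nonneg fun k _ => sq_nonneg _) hderiv hle (right_mem_Icc.2 ht)
  have hAc : Gf / (4 * Real.pi ^ 2 * ν) / (4 * Real.pi ^ 2 * ν) = Gf / (16 * Real.pi ^ 4 * ν ^ 2) := by
    rw [div_div]
    congr 1
    ring
  rw [hAc] at h
  exact h

/-- **The excess-weighted energy of a Galerkin state decays** (FMRT 2001, App. III.A.4,
(A.32)–(A.33) at the Galerkin level). Along a Galerkin solution on `𝕋²` with `ν ≥ 0` and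
force coefficients on the first shell,
`E(t) ≤ E(s) e^{-16π²ν(t-s)}`, `E(τ) = ∑_k w⁺(k) ‖α τ k‖²`, for `0 ≤ s ≤ t`
(`dE/dt = 2 ∑ w⁺ Re⟪α_k, V_k⟫ ≤ -16π²ν E`, `sum_excessWeight_mul_re_inner_galerkinField_le`). [cite: FoiasManleyRosaTemam2001, App. III.A.4 (A.32)–(A.33)] -/
theorem galerkin_excess_le_mul_exp (hν : 0 ≤ ν) (hS : ∀ k ∈ S, -k ∈ S)
    (hmem : ∀ t, α t ∈ galerkinSubspace S)
    (hα : ∀ T, ∀ t ∈ Icc 0 T, HasDerivWithinAt α (galerkinRHS S ν g (α t)) (Icc 0 T) t)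
    (hg1 : ∀ k : ↥S, freqNormSq (k : ℤ²) ≠ 1 → g k = 0) {s t : ℝ} (hs : 0 ≤ s) (hst : s ≤ t) :
    ∑ k : ↥S, excessWeight (k : ℤ²) * ‖α t k‖ ^ 2 ≤
      (∑ k : ↥S, excessWeight (k : ℤ²) * ‖α s k‖ ^ 2) * Real.exp (-(16 * Real.pi ^ 2 * ν) * (t - s)) := by
  have hg1' : ∀ k : ℤ², freqNormSq k ≠ 1 → coeffExt S g k = 0 := by
    intro k hk
    by_cases hkS : k ∈ S
    · rw [coeffExt_of_mem _ hkS]; exact hg1 ⟨k, hkS⟩ hk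
    · exact coeffExt_of_not_mem _ hkS
  have hderiv : ∀ τ ∈ Icc 0 t, HasDerivWithinAt (fun σ => ∑ k : ↥S, excessWeight (k : ℤ²) * ‖α σ k‖ ^ 2)
      (∑ k : ↥S, excessWeight (k : ℤ²) * (2 * (inner ℂ (α τ k) (galerkinRHS S ν g (α τ) k)).re)) (Icc 0 t) τ :=
    fun τ hτ => hasDerivWithinAt_sum_mul_norm_sq (hα t τ hτ) fun k => excessWeight k
  have hle : ∀ τ ∈ Icc 0 t,
      ∑ k : ↥S, excessWeight (k : ℤ²) * (2 * (inner ℂ (α τ k) (galerkinRHS S ν g (α τ) k)).re) ≤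
        -(16 * Real.pi ^ 2 * ν) * ∑ k : ↥S, excessWeight (k : ℤ²) * ‖α τ k‖ ^ 2 := by
    intro τ _
    have h := sum_excessWeight_mul_re_inner_galerkinField_le hν hS ((hmem τ).1.isConjSymm_coeffExt hS)
      (hmem τ).2.isTransversal_coeffExt hg1'
    rw [sum_coeffExt (fun k v => excessWeight k * (inner ℂ v (galerkinField ν S (coeffExt S g)
      (coeffExt S (α τ)) k)).re), sum_coeffExt (fun k v => excessWeight k * ‖v‖ ^ 2)] at h
    have h2 : ∑ k : ↥S, excessWeight (k : ℤ²) * (2 * (inner ℂ (α τ k) (galerkinRHS S ν g (α τ) k)).re) =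
        2 * ∑ k : ↥S, excessWeight (k : ℤ²) * (inner ℂ (α τ k) (galerkinField ν S (coeffExt S g)
          (coeffExt S (α τ)) k)).re := by
      rw [Finset.mul_sum]
      refine Finset.sum_congr rfl fun k _ => ?_
      rw [galerkinRHS_apply]
      ring
    rw [h2]
    linarith
  exact le_mul_exp_neg_of_hasDerivWithinAt_le hderiv hle hs hst le_rfl

/-- The excess-weighted energy is nonnegative. [folklore] -/
theorem galerkin_excess_nonneg (c : ↥S → ℂ²) : 0 ≤ ∑ k : ↥S, excessWeight (k : ℤ²) * ‖c k‖ ^ 2 :=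
  Finset.sum_nonneg fun _ _ => mul_nonneg (excessWeight_nonneg _) (sq_nonneg _)

/-- The excess-weighted energy is at most the enstrophy: `∑ w⁺ ‖α k‖² ≤ ‖∇u‖²`. [folklore] -/
theorem galerkin_excess_le_toReal_eGradNormSq (hS : ∀ k ∈ S, -k ∈ S) {c : ↥S → ℂ²}
    (hc : IsRealCoeff c) :
    ∑ k : ↥S, excessWeight (k : ℤ²) * ‖c k‖ ^ 2 ≤ (eGradNormSq (realTrigPoly S (coeffExt S c))).toReal := by
  rw [toReal_eGradNormSq_coeffExt hS hc, Finset.mul_sum]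
  refine Finset.sum_le_sum fun k _ => ?_
  rw [← mul_assoc]
  exact mul_le_mul_of_nonneg_right (excessWeight_le _) (sq_nonneg _)

/-- **The excess at time one is controlled by the data** (the time-averaged enstrophy bound
`ν∫₀¹ ‖∇u‖² ≤ ½|u₀|² + ∫₀¹ (f,u)`, FMRT 2001, App. II.A (A.40)–(A.42), combined with the decay
of `E`: the function `τ E(τ) + (2ν)⁻¹ ∑‖α τ k‖² - τ C` is non-increasing on `[0, 1]`). Along a
Galerkin solution as above with `ν > 0`, mean-free data and force on the first shell,
`E(1) ≤ (2ν)⁻¹ (2∑‖α 0 k‖² + ∑‖g k‖² + ∑‖g k‖²/(16π⁴ν²))`. [cite: FoiasManleyRosaTemam2001, App. II.A (A.40)–(A.42)] -/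
theorem galerkin_excess_one_le (hν : 0 < ν) (hS : ∀ k ∈ S, -k ∈ S) (hg : IsRealCoeff g)
    (hmem : ∀ t, α t ∈ galerkinSubspace S)
    (hα : ∀ T, ∀ t ∈ Icc 0 T, HasDerivWithinAt α (galerkinRHS S ν g (α t)) (Icc 0 T) t)
    (h0S : (0 : ℤ²) ∈ S) (hg0 : g ⟨0, h0S⟩ = 0) (hα0 : α 0 ⟨0, h0S⟩ = 0)
    (hg1 : ∀ k : ↥S, freqNormSq (k : ℤ²) ≠ 1 → g k = 0) :
    ∑ k : ↥S, excessWeight (k : ℤ²) * ‖α 1 k‖ ^ 2 ≤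
      (2 * ν)⁻¹ * (2 * (∑ k, ‖α 0 k‖ ^ 2) + (∑ k, ‖g k‖ ^ 2) +
        (∑ k, ‖g k‖ ^ 2) / (16 * Real.pi ^ 4 * ν ^ 2)) := by
  have hν0 : ν ≠ 0 := hν.ne'
  set Gf : ℝ := ∑ k, ‖g k‖ ^ 2 with hGf
  set ψ : ℝ → ℝ := fun τ => ∑ k, ‖α τ k‖ ^ 2 with hψ
  set E : ℝ → ℝ := fun τ => ∑ k : ↥S, excessWeight (k : ℤ²) * ‖α τ k‖ ^ 2 with hE
  set K : ℝ := ψ 0 + Gf / (16 * Real.pi ^ 4 * ν ^ 2) with hK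
  have hGf0 : 0 ≤ Gf := Finset.sum_nonneg fun k _ => sq_nonneg _
  have hψK : ∀ τ, 0 ≤ τ → ψ τ ≤ K := fun τ hτ =>
    galerkin_sum_norm_sq_le hν hS hg hmem hα h0S hg0 hα0 hτ
  have hg1' : ∀ k : ℤ², freqNormSq k ≠ 1 → coeffExt S g k = 0 := by
    intro k hk
    by_cases hkS : k ∈ S
    · rw [coeffExt_of_mem _ hkS]; exact hg1 ⟨k, hkS⟩ hk
    · exact coeffExt_of_not_mem _ hkS
  -- the derivatives of `E` and `ψ` within `[0, 1]`
  set E' : ℝ → ℝ := fun τ => ∑ k : ↥S, excessWeight (k : ℤ²) *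
    (2 * (inner ℂ (α τ k) (galerkinRHS S ν g (α τ) k)).re) with hE'
  set P : ℝ → ℝ := fun τ => ∫ x, ⟪realTrigPoly S (coeffExt S g) x,
    realTrigPoly S (coeffExt S (α τ)) x⟫_ℝ with hP
  set G : ℝ → ℝ := fun τ => (eGradNormSq (realTrigPoly S (coeffExt S (α τ)))).toReal with hG
  have hEd : ∀ τ ∈ Icc (0 : ℝ) 1, HasDerivWithinAt E (E' τ) (Icc 0 1) τ :=
    fun τ hτ => hasDerivWithinAt_sum_mul_norm_sq (hα 1 τ hτ) fun k => excessWeight k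
  have hψd : ∀ τ ∈ Icc (0 : ℝ) 1, HasDerivWithinAt ψ (2 * (-(ν * G τ) + P τ)) (Icc 0 1) τ :=
    fun τ hτ => hasDerivWithinAt_energy ν hS (hα 1 τ hτ) (hmem τ) hg
  have hE'le : ∀ τ ∈ Icc (0 : ℝ) 1, E' τ ≤ 0 := by
    intro τ _
    have h := sum_excessWeight_mul_re_inner_galerkinField_le hν.le hS ((hmem τ).1.isConjSymm_coeffExt hS)
      (hmem τ).2.isTransversal_coeffExt hg1'
    rw [sum_coeffExt (fun k v => excessWeight k * (inner ℂ v (galerkinField ν S (coeffExt S g)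
      (coeffExt S (α τ)) k)).re), sum_coeffExt (fun k v => excessWeight k * ‖v‖ ^ 2)] at h
    have h2 : E' τ = 2 * ∑ k : ↥S, excessWeight (k : ℤ²) * (inner ℂ (α τ k)
        (galerkinField ν S (coeffExt S g) (coeffExt S (α τ)) k)).re := by
      rw [hE', Finset.mul_sum]
      refine Finset.sum_congr rfl fun k _ => ?_
      rw [galerkinRHS_apply]
      ring
    have hEτ : 0 ≤ ∑ k : ↥S, excessWeight (k : ℤ²) * ‖α τ k‖ ^ 2 := galerkin_excess_nonneg (α τ)
    have hEτ' : 0 ≤ 8 * Real.pi ^ 2 * ν * ∑ k : ↥S, excessWeight (k : ℤ²) * ‖α τ k‖ ^ 2 := by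
      positivity
    rw [h2]
    nlinarith
  have hPle : ∀ τ ∈ Icc (0 : ℝ) 1, P τ ≤ (Gf + K) / 2 := by
    intro τ hτ
    rw [hP]
    dsimp only
    rw [integral_inner_realTrigPoly_coeffExt hS hg (hmem τ).1]
    have h1 : ∑ k, (inner ℂ (g k) (α τ k)).re ≤ ∑ k, (‖g k‖ ^ 2 + ‖α τ k‖ ^ 2) / 2 := by
      refine Finset.sum_le_sum fun k _ => ?_
      have h : (inner ℂ (g k) (α τ k)).re ≤ ‖g k‖ * ‖α τ k‖ := re_inner_le_norm (𝕜 := ℂ) (g k) (α τ k)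
      nlinarith [two_mul_le_add_sq ‖g k‖ ‖α τ k‖]
    refine h1.trans ?_
    rw [← Finset.sum_div, Finset.sum_add_distrib]
    have := hψK τ hτ.1
    gcongr
  -- the comparison function `Λ(τ) = τ E(τ) + ψ(τ)/(2ν) - τ (Gf + K)/(2ν)`
  set Λ : ℝ → ℝ := fun τ => τ * E τ + (2 * ν)⁻¹ * ψ τ - τ * ((Gf + K) / (2 * ν)) with hΛ
  have hΛd : ∀ τ ∈ Icc (0 : ℝ) 1, HasDerivWithinAt Λ
      (1 * E τ + τ * E' τ + (2 * ν)⁻¹ * (2 * (-(ν * G τ) + P τ)) - 1 * ((Gf + K) / (2 * ν)))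
      (Icc 0 1) τ := by
    intro τ hτ
    have h1 := (hasDerivWithinAt_id τ (Icc 0 1)).mul (hEd τ hτ)
    have h2 := (hψd τ hτ).const_mul (2 * ν)⁻¹
    have h3 := (hasDerivWithinAt_id τ (Icc 0 1)).mul_const ((Gf + K) / (2 * ν))
    exact (h1.add h2).sub h3
  have hΛle : ∀ τ ∈ Ioo (0 : ℝ) 1,
      1 * E τ + τ * E' τ + (2 * ν)⁻¹ * (2 * (-(ν * G τ) + P τ)) - 1 * ((Gf + K) / (2 * ν)) ≤ 0 := by
    intro τ hτ
    have hτI : τ ∈ Icc (0 : ℝ) 1 := ⟨hτ.1.le, hτ.2.le⟩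
    have hEG : E τ ≤ G τ := galerkin_excess_le_toReal_eGradNormSq hS (hmem τ).1
    have hE'0 := hE'le τ hτI
    have hPτ := hPle τ hτI
    have hτE' : τ * E' τ ≤ 0 := mul_nonpos_of_nonneg_of_nonpos hτ.1.le hE'0
    have hid : (2 * ν)⁻¹ * (2 * (-(ν * G τ) + P τ)) = -G τ + P τ / ν := by
      field_simp
    rw [hid]
    have hPν : P τ / ν ≤ (Gf + K) / (2 * ν) := by
      rw [div_le_div_iff₀ hν (by positivity)]
      nlinarith
    nlinarith
  have hmono := apply_le_apply_of_hasDerivAt_nonpos (a := 0) (b := 1)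
    (φ' := fun τ => 1 * E τ + τ * E' τ + (2 * ν)⁻¹ * (2 * (-(ν * G τ) + P τ)) - 1 * ((Gf + K) / (2 * ν)))
    zero_le_one (fun τ hτ => (hΛd τ hτ).continuousWithinAt)
    (fun τ hτ => (hΛd τ ⟨hτ.1.le, hτ.2.le⟩).hasDerivAt (Icc_mem_nhds hτ.1 hτ.2)) hΛle
  -- read off `E 1`
  have hΛ1 : Λ 1 = E 1 + (2 * ν)⁻¹ * ψ 1 - (Gf + K) / (2 * ν) := by simp only [hΛ]; ring
  have hΛ0 : Λ 0 = (2 * ν)⁻¹ * ψ 0 := by simp only [hΛ]; ring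
  rw [hΛ1, hΛ0] at hmono
  have hψ1 : 0 ≤ ψ 1 := Finset.sum_nonneg fun k _ => sq_nonneg _
  have hψ0 : 0 ≤ ψ 0 := Finset.sum_nonneg fun k _ => sq_nonneg _
  have h2ν : 0 < (2 * ν)⁻¹ := by positivity
  have hfinal : E 1 ≤ (2 * ν)⁻¹ * (ψ 0 + Gf + K) := by
    have : (Gf + K) / (2 * ν) = (2 * ν)⁻¹ * (Gf + K) := by rw [div_eq_inv_mul]
    rw [this] at hmono
    nlinarith [mul_nonneg h2ν.le hψ1]
  refine hfinal.trans (le_of_eq ?_)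
  rw [hK]
  ring

end GalerkinSolution

/-! ### Coefficient bookkeeping: data, force, partial sums -/

section Bookkeeping

/-- **Mean-zero data have no mean Fourier mode**: `𝓕(complexify ∘ v)(0) = 0` for integrable
`v` with `∫ v = 0` (pairing with the constant modes). [folklore] -/
theorem mFourierCoeff_zero_of_hasZeroMean {v : 𝕋² → E²} (hv : Integrable v volume)
    (hmean : HasZeroMean v) : mFourierCoeff (EuclideanSpace.complexify ∘ v) 0 = 0 := by
  set z := mFourierCoeff (EuclideanSpace.complexify ∘ v) 0
  have h := integral_inner_realTrigPoly_zero_of_hasZeroMean hv hmean z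
  rw [integral_inner_realTrigPoly_singleton hv] at h
  have hn : ‖z‖ ^ 2 = 0 := by rw [@norm_sq_eq_re_inner ℂ]; exact h
  exact norm_eq_zero.1 (pow_eq_zero_iff two_ne_zero |>.1 hn)

/-- The first-mode force has Fourier coefficients only on the first shell: `𝓕(f_α)(k) = 0`
unless `|k|² = 1`. [folklore] -/
theorem mFourierCoeff_marchioroForce_eq_zero (a : ℝ) {k : ℤ²} (hk : freqNormSq k ≠ 1) :
    mFourierCoeff (EuclideanSpace.complexify ∘ marchioroForce a) k = 0 := by
  have h1 : k ≠ firstModeFreq := fun h => hk (mem_shellOne.1 (h ▸ firstModeFreq_mem_shellOne))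
  have h2 : k ≠ -firstModeFreq := fun h =>
    hk (mem_shellOne.1 (h ▸ neg_mem_shellOne firstModeFreq_mem_shellOne))
  rw [marchioroForce_eq_realTrigPoly, mFourierCoeff_realTrigPoly_singleton]
  simp [h1, h2]

/-- **The force is its own Galerkin truncation** at every order `N ≥ 1`: `P_N f_α = f_α`
(the force is band-limited to `|k|² = 1 ≤ N²`). [folklore] -/
theorem fourierTruncate_marchioroForce (a : ℝ) {N : ℕ} (hN : 1 ≤ N) :
    fourierTruncate N (marchioroForce a) = marchioroForce a := by
  refine fourierTruncate_eq_self (marchioroForce_continuous a) fun k hk => ?_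
  refine mFourierCoeff_marchioroForce_eq_zero a (fun h1 => ?_)
  rw [h1] at hk
  have : (1 : ℝ) ≤ (N : ℝ) ^ 2 := by
    have : (1 : ℝ) ≤ N := by exact_mod_cast hN
    nlinarith
  linarith

/-- Bessel over an arbitrary finite set of frequencies: `∑_{k∈S'} ‖v̂(k)‖² ≤ ∫ ‖v‖²` for
`v ∈ L²`. [folklore] -/
theorem sum_sq_norm_mFourierCoeff_le_integral {v : 𝕋² → E²} (hv : MemLp v 2 volume)
    (S' : Finset ℤ²) :
    ∑ k ∈ S', ‖mFourierCoeff (EuclideanSpace.complexify ∘ v) k‖ ^ 2 ≤ ∫ x, ‖v x‖ ^ 2 := by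
  have h := hasSum_sq_norm_mFourierCoeff_complexify hv
  rw [← h.tsum_eq]
  exact h.summable.sum_le_tsum S' fun k _ => sq_nonneg _

/-- A finite sum of a nonnegative function supported in `S` is dominated by its sum over `S`. [folklore] -/
theorem sum_le_sum_of_support_subset {F : ℤ² → ℝ} (hF : ∀ k, 0 ≤ F k) {S S' : Finset ℤ²}
    (hsupp : ∀ k ∉ S, F k = 0) : ∑ k ∈ S', F k ≤ ∑ k ∈ S, F k := by
  classical
  calc ∑ k ∈ S', F k = ∑ k ∈ S' ∩ S, F k := by
        rw [← Finset.sum_filter_add_sum_filter_not S' (fun k => k ∈ S)]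
        have h0 : ∑ k ∈ S'.filter (fun k => k ∉ S), F k = 0 :=
          Finset.sum_eq_zero fun k hk => hsupp k (Finset.mem_filter.1 hk).2
        rw [h0, add_zero, Finset.filter_mem_eq_inter]
    _ ≤ ∑ k ∈ S, F k :=
        Finset.sum_le_sum_of_subset_of_nonneg Finset.inter_subset_right fun k _ _ => hF k

/-- The Fourier coefficients of a Galerkin state are its (extended) coefficient vector. [folklore] -/
theorem mFourierCoeff_realTrigPoly_coeffExt {S : Finset ℤ²} (hS : ∀ k ∈ S, -k ∈ S)
    {c : ↥S → ℂ²} (hc : IsRealCoeff c) (k : ℤ²) :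
    mFourierCoeff (EuclideanSpace.complexify ∘ realTrigPoly S (coeffExt S c)) k = coeffExt S c k := by
  rw [mFourierCoeff_realTrigPoly hS (hc.isConjSymm_coeffExt hS)]
  split_ifs with hk
  · rfl
  · rw [coeffExt_of_not_mem _ hk]

end Bookkeeping

/-! ### The Galerkin scheme with exact first-mode force, its limit, and the discharge -/

section Scheme

/-- **Half 1 of the printed proof of Marchioro's theorem, discharged** (existence form;
FMRT 2001, App. III.A.4 (A.32)–(A.34) with App. II.A (A.42), along the Galerkin method of
Ch. II Thm. 7.1 / Constantin–Foias 1988 Ch. 8 as proved in the tree,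
`IsHopfGalerkinScheme.exists_limitField` / `.isLerayHopfOn_limit`). For every `α`, `ν > 0` and
mean-zero divergence-free datum `u₀ ∈ L²(𝕋²)` there is a global Leray–Hopf solution of the 2-D
Navier–Stokes equations with force `f_α`, bounded in `L²` uniformly in time and with enstrophy
excess tending to zero: it is the coefficientwise limit of the Fourier–Galerkin approximations
driven by the *exact* force (which is its own truncation), along which the mean mode stays zero,
`∑‖α k‖² ≤ |u₀|² + |f|²/(16π⁴ν²)` (A.42), and the excess obeys `E ≤ C e^{-16π²ν(t-1)}` for
`t ≥ 1` uniformly in the order (`galerkin_excess_le_mul_exp`, `galerkin_excess_one_le`); the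
bounds pass to the limit by Fatou on finite sets of frequencies. [cite: FoiasManleyRosaTemam2001, App. III.A.4 (A.32)–(A.34)] -/
theorem firstMode_exists_lerayHopf_enstrophyExcess_tendsto_zero_holds :
    firstMode_exists_lerayHopf_enstrophyExcess_tendsto_zero := by
  intro a ν hν u₀ hu₀ hdiv hmean
  classical
  -- the force and its coefficients
  set f : 𝕋² → E² := marchioroForce a with hf_def
  have hf_smooth : IsSmooth f := isSmooth_marchioroForce a
  have hf_int : Integrable f volume := hf_smooth.integrable
  have hfm : AEStronglyMeasurable (stLift fun _ : ℝ => f) (volume.restrict (Ioi 0 ×ˢ univ)) :=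
    aestronglyMeasurable_stLift_marchioroForce a _
  have hf₂ : ∀ T : ℝ, 0 < T → ∫⁻ _ in Ioo 0 T, ∫⁻ x, ‖f x‖ₑ ^ 2 < ⊤ := fun T _ =>
    lintegral_enorm_sq_marchioroForce_lt_top a T
  set fhat : ℤ² → ℂ² := fun k => mFourierCoeff (EuclideanSpace.complexify ∘ f) k with hfhat
  set uhat₀ : ℤ² → ℂ² := fun k => mFourierCoeff (EuclideanSpace.complexify ∘ u₀) k with huhat₀
  have hu₀_int : Integrable u₀ volume := hu₀.integrable one_le_two
  -- the frequency sets `S n = freqBall (n + 1)`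
  set S : ℕ → Finset ℤ² := fun n => freqBall (n + 1) with hS_def
  have hS : ∀ n, ∀ k ∈ S n, -k ∈ S n := fun n => neg_mem_freqBall_of_mem
  have h0S : ∀ n, (0 : ℤ²) ∈ S n := fun n => zero_mem_freqBall _
  -- force and data coefficient vectors
  set gc : (n : ℕ) → ↥(S n) → ℂ² := fun n k => fhat k with hgc
  set c₀ : (n : ℕ) → ↥(S n) → ℂ² := fun n k => uhat₀ k with hc₀
  have hg_real : ∀ n, IsRealCoeff (gc n) := fun n => isRealCoeff_mFourierCoeff hf_int
  have hc₀_mem : ∀ n, c₀ n ∈ galerkinSubspace (S n) := fun n =>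
    ⟨isRealCoeff_mFourierCoeff hu₀_int, isSolenoidalCoeff_restrict (hdiv.isTransversal_mFourierCoeff hu₀ (S n))⟩
  have hg0 : ∀ n, gc n ⟨0, h0S n⟩ = 0 := fun n => by
    show fhat 0 = 0
    exact mFourierCoeff_marchioroForce_zero a
  have hg1 : ∀ n (k : ↥(S n)), freqNormSq (k : ℤ²) ≠ 1 → gc n k = 0 := fun n k hk =>
    mFourierCoeff_marchioroForce_eq_zero a hk
  have hc₀0 : ∀ n, c₀ n ⟨0, h0S n⟩ = 0 := fun n => by
    show uhat₀ 0 = 0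
    exact mFourierCoeff_zero_of_hasZeroMean hu₀_int hmean
  -- the global Galerkin solutions
  have hsol : ∀ n : ℕ, ∃ β : ℝ → ↥(S n) → ℂ², β 0 = c₀ n ∧ (∀ t, β t ∈ galerkinSubspace (S n)) ∧
      ContinuousOn β (Ici 0) ∧
      ∀ T, ∀ t ∈ Icc 0 T, HasDerivWithinAt β (galerkinRHS (S n) ν (gc n) (β t)) (Icc 0 T) t :=
    fun n => exists_galerkin_solution ν hν.le (hS n) (g := fun _ => gc n) continuous_const
      (fun _ => hg_real n) (hc₀_mem n)
  choose β hβ0 hβmem hβcont hβderiv using hsol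
  -- the fields
  set F : ℕ → ℝ → 𝕋² → E² := fun n _ => realTrigPoly (S n) (coeffExt (S n) (gc n)) with hF
  set U : ℕ → ℝ → 𝕋² → E² := fun n t => realTrigPoly (S n) (coeffExt (S n) (β n t)) with hU
  have hFf : ∀ n t, F n t = f := by
    intro n t
    show realTrigPoly (S n) (coeffExt (S n) fun k : ↥(S n) => fhat k) = f
    rw [realTrigPoly_coeffExt_restrict, hfhat, ← fourierTruncate_eq]
    exact fourierTruncate_marchioroForce a (Nat.le_add_left 1 n)
  have hU0 : ∀ n, U n 0 = fourierTruncate (n + 1) u₀ := by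
    intro n
    show realTrigPoly (S n) (coeffExt (S n) (β n 0)) = _
    rw [hβ0 n, fourierTruncate_eq]
    exact realTrigPoly_coeffExt_restrict _
  have hband : ∀ {n : ℕ} {b : 𝕋² → E²}, IsGalerkinMode (n + 1) b →
      ∀ k ∉ S n, mFourierCoeff (EuclideanSpace.complexify ∘ b) k = 0 :=
    fun hb k hk => hb.mFourierCoeff_eq_zero (not_mem_freqBall.1 hk)
  -- the scheme
  have hScheme : IsHopfGalerkinScheme ν (fun _ => f) u₀ (fun n => n + 1) F U :=
    { tendsto_order := tendsto_add_atTop_nat 1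
      smooth_force := fun n => contDiff_stLift_realTrigPoly (g := fun _ : ℝ => gc n) contDiff_const
      tendsto_force := fun T _ => by
        have h0 : (fun n => ∫⁻ t in Ioo 0 T, ∫⁻ x, ‖F n t x - f x‖ₑ ^ 2) = fun _ => 0 := by
          funext n
          simp only [hFf, sub_self, enorm_zero, ne_eq, OfNat.ofNat_ne_zero, not_false_eq_true,
            zero_pow, lintegral_zero]
        rw [h0]
        exact tendsto_const_nhds
      continuousOn := fun n => continuousOn_stLift_realTrigPoly (hβcont n)
      isGalerkinMode := fun n t _ =>
        have h := galerkin_slice_props (hS n) (hβmem n t)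
        ⟨h.1, h.2.1, fun k hk => h.2.2.2 k (not_mem_freqBall.2 hk)⟩
      isWeaklyDivFree := fun n t _ => (galerkin_slice_props (hS n) (hβmem n t)).2.2.1
      galerkin := fun n b hb s t hs hst =>
        galerkin_test_identity ν (hS n) (g := fun _ => gc n) continuous_const (fun _ => hg_real n)
          (hβmem n) (hβderiv n) hb.isSmooth hb.isDivFree (hband hb) hs hst
      energy_eq := fun n s t hs hst =>
        galerkin_energy_identity ν (hS n) (g := fun _ => gc n) continuous_const (fun _ => hg_real n)
          (hβmem n) (hβderiv n) hs hst
      initial_inner := fun n b hb => by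
        rw [hU0 n]
        exact integral_inner_fourierTruncate_eq hu₀ (hb.isSmooth.memLp 2) (hband hb)
      tendsto_initial := by
        have heq : (fun n => eLpNorm (U n 0 - u₀) 2 volume) =
            fun n => eLpNorm (fourierTruncate (n + 1) u₀ - u₀) 2 volume := by
          funext n; rw [hU0 n]
        rw [heq]
        exact (tendsto_eLpNorm_fourierTruncate_sub hu₀).comp (tendsto_add_atTop_nat 1) }
  -- the limit field and the global Leray–Hopf solution
  obtain ⟨φ, hφ, u, hum, hu, hc⟩ := hScheme.exists_limitField hν.le hu₀ hfm hf₂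
  have hLH : IsGlobalLerayHopf ν (fun _ => f) u₀ u := fun T hT =>
    (hScheme.comp_strictMono hφ).isLerayHopfOn_limit hν hu₀ hdiv hfm hf₂ hum hu hc hT
  -- uniform bounds at the Galerkin level
  set E0 : ℝ := ∫ x, ‖u₀ x‖ ^ 2 with hE0
  set Ef : ℝ := ∫ x, ‖f x‖ ^ 2 with hEf
  set K : ℝ := E0 + Ef / (16 * Real.pi ^ 4 * ν ^ 2) with hK
  set C : ℝ := (2 * ν)⁻¹ * (2 * E0 + Ef + Ef / (16 * Real.pi ^ 4 * ν ^ 2)) with hC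
  have hψ0 : ∀ n, ∑ k, ‖β n 0 k‖ ^ 2 ≤ E0 := by
    intro n
    rw [hβ0 n]
    show ∑ k : ↥(S n), ‖uhat₀ k‖ ^ 2 ≤ E0
    rw [Finset.sum_coe_sort (S n) (fun k => ‖uhat₀ k‖ ^ 2)]
    exact sum_sq_norm_mFourierCoeff_le_integral hu₀ (S n)
  have hGf : ∀ n, ∑ k, ‖gc n k‖ ^ 2 ≤ Ef := by
    intro n
    show ∑ k : ↥(S n), ‖fhat k‖ ^ 2 ≤ Ef
    rw [Finset.sum_coe_sort (S n) (fun k => ‖fhat k‖ ^ 2)]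
    exact sum_sq_norm_mFourierCoeff_le_integral (hf_smooth.memLp 2) (S n)
  have hνsq : 0 < 16 * Real.pi ^ 4 * ν ^ 2 := by positivity
  have hbound_n : ∀ n t, 0 ≤ t → ∑ k, ‖β n t k‖ ^ 2 ≤ K := by
    intro n t ht
    refine (galerkin_sum_norm_sq_le hν (hS n) (hg_real n) (hβmem n) (hβderiv n) (h0S n) (hg0 n)
      (by rw [hβ0 n]; exact hc₀0 n) ht).trans ?_
    have h1 := hψ0 n
    have h2 := hGf n
    rw [hK]
    gcongr
  have hexcess_n : ∀ n t, 1 ≤ t → ∑ k : ↥(S n), excessWeight (k : ℤ²) * ‖β n t k‖ ^ 2 ≤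
      C * Real.exp (-(16 * Real.pi ^ 2 * ν) * (t - 1)) := by
    intro n t ht
    have h1 := galerkin_excess_le_mul_exp hν.le (hS n) (hβmem n) (hβderiv n) (hg1 n)
      zero_le_one ht
    have h2 := galerkin_excess_one_le hν (hS n) (hg_real n) (hβmem n) (hβderiv n) (h0S n) (hg0 n)
      (by rw [hβ0 n]; exact hc₀0 n) (hg1 n)
    have h3 : (2 * ν)⁻¹ * (2 * (∑ k, ‖β n 0 k‖ ^ 2) + (∑ k, ‖gc n k‖ ^ 2) +
        (∑ k, ‖gc n k‖ ^ 2) / (16 * Real.pi ^ 4 * ν ^ 2)) ≤ C := by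
      have ha := hψ0 n
      have hb := hGf n
      rw [hC]
      gcongr
    exact h1.trans (mul_le_mul_of_nonneg_right (h2.trans h3) (Real.exp_pos _).le)
  -- Fourier coefficients of the Galerkin states
  have hcoefU : ∀ n t k, mFourierCoeff (EuclideanSpace.complexify ∘ U n t) k = coeffExt (S n) (β n t) k :=
    fun n t k => mFourierCoeff_realTrigPoly_coeffExt (hS n) (hβmem n t).1 k
  -- passage to the limit, 1: the uniform `L²` bound
  have hB1 : ∀ t, 0 ≤ t → ∫ x, ‖u t x‖ ^ 2 ≤ K := by
    intro t ht
    have hsum : HasSum (fun k : ℤ² => ‖mFourierCoeff (EuclideanSpace.complexify ∘ u t) k‖ ^ 2)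
        (∫ x, ‖u t x‖ ^ 2) := hasSum_sq_norm_mFourierCoeff_complexify (hu t ht)
    rw [← hsum.tsum_eq]
    refine hsum.summable.tsum_le_of_sum_le fun S' => ?_
    -- each finite partial sum is a limit of Galerkin partial sums, bounded by `K`
    have hlim : Tendsto (fun j => ∑ k ∈ S', ‖mFourierCoeff (EuclideanSpace.complexify ∘ U (φ j) t) k‖ ^ 2)
        atTop (𝓝 (∑ k ∈ S', ‖mFourierCoeff (EuclideanSpace.complexify ∘ u t) k‖ ^ 2)) :=
      tendsto_finsetSum _ fun k _ => ((hc t ht k).norm).pow 2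
    refine le_of_tendsto' hlim fun j => ?_
    calc ∑ k ∈ S', ‖mFourierCoeff (EuclideanSpace.complexify ∘ U (φ j) t) k‖ ^ 2
        ≤ ∑ k ∈ S (φ j), ‖coeffExt (S (φ j)) (β (φ j) t) k‖ ^ 2 := by
          simp_rw [hcoefU]
          exact sum_le_sum_of_support_subset (fun k => sq_nonneg _)
            (fun k hk => by rw [coeffExt_of_not_mem _ hk, norm_zero, zero_pow two_ne_zero])
      _ = ∑ k, ‖β (φ j) t k‖ ^ 2 := sum_coeffExt (fun _ v => ‖v‖ ^ 2) _
      _ ≤ K := hbound_n (φ j) t ht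
  -- passage to the limit, 2: the enstrophy excess
  have hB2 : ∀ t, 1 ≤ t → enstrophyExcess (u t) ≤
      ENNReal.ofReal (C * Real.exp (-(16 * Real.pi ^ 2 * ν) * (t - 1))) := by
    intro t ht
    have ht0 : 0 ≤ t := zero_le_one.trans ht
    rw [enstrophyExcess_eq_tsum_ofReal, ENNReal.tsum_eq_iSup_sum]
    refine iSup_le fun S' => ?_
    have hlim : Tendsto (fun j => ∑ k ∈ S', ENNReal.ofReal (excessWeight k *
        ‖mFourierCoeff (EuclideanSpace.complexify ∘ U (φ j) t) k‖ ^ 2)) atTop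
        (𝓝 (∑ k ∈ S', ENNReal.ofReal (excessWeight k *
          ‖mFourierCoeff (EuclideanSpace.complexify ∘ u t) k‖ ^ 2))) :=
      tendsto_finsetSum _ fun k _ =>
        ENNReal.tendsto_ofReal ((((hc t ht0 k).norm).pow 2).const_mul _)
    refine le_of_tendsto' hlim fun j => ?_
    rw [← ENNReal.ofReal_sum_of_nonneg fun k _ => mul_nonneg (excessWeight_nonneg k) (sq_nonneg _)]
    refine ENNReal.ofReal_le_ofReal ?_
    calc ∑ k ∈ S', excessWeight k * ‖mFourierCoeff (EuclideanSpace.complexify ∘ U (φ j) t) k‖ ^ 2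
        ≤ ∑ k ∈ S (φ j), excessWeight k * ‖coeffExt (S (φ j)) (β (φ j) t) k‖ ^ 2 := by
          simp_rw [hcoefU]
          exact sum_le_sum_of_support_subset (fun k => mul_nonneg (excessWeight_nonneg k) (sq_nonneg _))
            (fun k hk => by rw [coeffExt_of_not_mem _ hk, norm_zero, zero_pow two_ne_zero, mul_zero])
      _ = ∑ k : ↥(S (φ j)), excessWeight (k : ℤ²) * ‖β (φ j) t k‖ ^ 2 := sum_coeffExt (fun k v => excessWeight k * ‖v‖ ^ 2) _
      _ ≤ C * Real.exp (-(16 * Real.pi ^ 2 * ν) * (t - 1)) := hexcess_n (φ j) t ht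
  -- conclusion
  refine ⟨u, hLH, ⟨K, hB1⟩, ?_⟩
  have hdecay : Tendsto (fun t => ENNReal.ofReal (C * Real.exp (-(16 * Real.pi ^ 2 * ν) * (t - 1))))
      atTop (𝓝 0) := by
    rw [← ENNReal.ofReal_zero]
    refine ENNReal.tendsto_ofReal ?_
    have h1 : Tendsto (fun t : ℝ => -(16 * Real.pi ^ 2 * ν) * (t - 1)) atTop atBot := by
      have hc : -(16 * Real.pi ^ 2 * ν) < 0 := by
        have : 0 < 16 * Real.pi ^ 2 * ν := by positivity
        linarith
      exact (tendsto_atTop_add_const_right _ (-1) tendsto_id).const_mul_atTop_of_neg hc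
    have h2 := Real.tendsto_exp_atBot.comp h1
    simpa using h2.const_mul C
  refine tendsto_of_tendsto_of_tendsto_of_le_of_le' tendsto_const_nhds hdecay
    (Eventually.of_forall fun t => bot_le) ?_
  filter_upwards [eventually_ge_atTop 1] with t ht
  exact hB2 t ht

end Scheme

end Literature.Barriers.AnomalousDissipation

end
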